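import Literature.AlgebraicGeometry.HodgeTheory.CentreTimesCMCurveNoEmbedding
import Literature.AlgebraicGeometry.HodgeTheory.UnitaryTwoOneTimesCMCurveWeilClasses
import HarnessLib

/-!
# Moonen–Zarhin 1999 Thm. 0.2 (2), case (f) with `End⁰(X₂) = k`: product span with the printed hypotheses, and the Hodge conjecture for `X₀ × X₁ × X₂` reduced to the Weil classes of the fourfold `X₁ × X₂`

Family `hodge`, layer `Literature/AlgebraicGeometry/HodgeTheory`. Research context: cell `pub-hodge-ring2` (HONEST
FRAMING: research route conditional on HC_CM; not a corollary; Q11.4-sentence-2 already refuted in dim ≥ 3),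
Literature lane, programme R31-E (lit gen 62): the junction of R31 (`CentreTimesCMCurveNoEmbedding`: case (f)
sentences 1–2 as product span, with a displayed hypothesis `hcen`) and R30 (`UnitaryTwoOneTimesCMCurveWeilClasses`:
case (a1), `B•(X₁ × X₂) ⊆ D• + W_k`). Theorems only (no definition, no named fact, D-0026; nothing admitted); the
Hodge-conjecture statement of §2 takes the tree's EXISTING named fact
`Markman2025_weilClasses_algebraic_abelianFourfold` (algebraicity of Weil classes on abelian fourfolds) as an explicit
HYPOTHESIS — it is not discharged and not restated here.

PRINTED RESULT. B. Moonen, Yu. Zarhin, *Hodge classes on abelian varieties of low dimension*, Math. Ann. 315 (1999)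
711–733 [held: `paper:arxiv-math_9901113`, TeX chunk p0001 L132–L134 and L157–L162]: case (f) «The abelian variety
`X` is isogenous to a product `X_0 × X_1 × X_2`, where `X_0` is an elliptic curve, where `X_1` and `X_2` are as in
(a)» [(a): «`X_1` is an elliptic curve with complex multiplication by an imaginary quadratic field `k` and … `X_2` is
a simple abelian threefold such that there exists an embedding `k ↪ End⁰(X_2)`»] «and such that `X_0` and `X_1` are
not isogenous», and Thm. 0.2 «(2) Suppose we are in case (f). Then `Hg(X) = Hg(X_0) × Hg(X_1 × X_2)`. For every
`n ≥ 1` the Hodge ring `B•(Xⁿ)` is generated by the images of `B•(X_0ⁿ)` and `B•(X_1ⁿ × X_2ⁿ)`. In particular,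
`B•(X)` is generated by the divisor classes `D•(X)` together with the pull-backs of the Weil classes in
`W_k ⊂ B²(X_1 × X_2)`.»; with Thm. 0.1 (1) for case (a) «the Hodge ring `B•(X)` is generated by the subalgebra
`D•(X)` of divisor classes together with the space of Weil classes `W_k ⊂ B²(X)`».

WHAT IS PROVED. In the sub-case `End⁰(X₂) = k` of (a) (`dim_ℚ End⁰(X₂) = 2`, `φ ≫ φ = -d` on `X₂`; Moonen–Zarhin's
(a) also allows a sextic CM field `End⁰(X₂) ⊋ k`, typed for sentences 1–2 in `CentreTimesCMCurveBalancedProducts`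
via odd dimension, not here):
* §1 the hypothesis `hcen` of the tree's case (f) theorem holds — a square root of `-d₀` in `End⁰(X₂) = ℚ + ℚφ` forces
  `d₀ = q²d`, i.e. `End⁰(X₀) ≅ k`, i.e. `X₀ ∼ X₁` («Note that `End⁰(E) = End⁰(Y_1)` implies that `E ∼ Y_1`, which we
  excluded», §5 (5.11)) — so sentences 1–2 hold with exactly the printed hypotheses
  (`hodgeClassesProductSpan_powSucc_powSucc_caseF_of_finrank_two`);
* §2 sentence 3 in its Hodge-conjecture reading: every Hodge class of `X₀ × (X₁ × X₂)` is a combination of products of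
  Hodge classes of `X₀` (divisors) and of `X₁ × X₂` (divisors and Weil classes, R30), hence the Hodge conjecture for
  `X = X₀ × X₁ × X₂` — and for everything isogenous to it — holds AS SOON AS the Weil classes `W_k ⊂ B²(X₁ × X₂)` of
  the fourfold `X₁ × X₂` are algebraic (`hodgeConjectureFor_caseF_of_weilClassesFourfold`; multiplicities `(2,1)` on
  `X₂` and the matching CM type on `X₁`, as in R30). Nothing is claimed about `D²(X) ≠ B²(X)`.

## References
* [MoonenZarhin1999LowDim] B. J. J. Moonen, Yu. G. Zarhin, Math. Ann. 315 (1999), 711–733; Thm. 0.2 (2) case (f),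
  Thm. 0.1 (1) case (a), §5 (5.11), (5.12) (held: `paper:arxiv-math_9901113`, chunks p0001, p0010, p0011).
  [cite: MoonenZarhin1999LowDim, Thm. 0.2 (2) with case (f)]
* [vanGeemen1994HodgeAV] B. van Geemen, *An introduction to the Hodge conjecture for abelian varieties* (1994),
  Lemma 3.7 and Thm. 6.12. [cite: vanGeemen1994HodgeAV, Lemma 3.7]
* [DeligneMilne1982Tannakian] P. Deligne, J. Milne, *Tannakian categories*, LNM 900 (1982), §6 Thm. 6.20.
  [cite: DeligneMilne1982Tannakian, §6 Thm. 6.20]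
* [MumfordAV1970] D. Mumford, *Abelian Varieties* (1970), §19 Cor. 2 of Thm. 1 (p. 174). [cite: MumfordAV1970, §19 Cor. 2 of Thm. 1 (p. 174)]
-/

noncomputable section

open scoped TensorProduct
open CategoryTheory

namespace Literature.AlgebraicGeometry.HodgeTheory

open Literature.AlgebraicGeometry.Motives Literature.AlgebraicGeometry.Motives.HodgeStructure
open Literature.AlgebraicGeometry.ComplexMultiplication
open Literature.AlgebraicGeometry.Milne1999 (IsOfCMType)
open Literature.NumberTheory.ComplexMultiplication
open Literature.AlgebraicTopology.SingularHomology

variable {X₀ X₁ X₂ : AbelianVariety ℂ}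

/-! ### §1 Case (f) with `End⁰(X₂) = k`: the hypothesis `hcen` from «`X₀` and `X₁` are not isogenous» -/

/-- **`End⁰(X₂) = k = ℚ(√-d)` contains a square root of `-d₀` only if `d₀ = q²d`**: for `dim_ℚ End⁰(X₂) = 2` and
`φ ≫ φ = -d` (`d > 0`), and `d₀ > 0` with `d₀ ≠ q²d` for all rational `q`, no central (indeed no) element of
`End⁰(X₂)` squares to `-d₀` (the tree's `forall_mul_self_ne_of_forall_ne_sq_mul`). [cite: MoonenZarhin1999LowDim, §5 (5.11)]
[cite: MumfordAV1970, §19 Cor. 2 of Thm. 1 (p. 174)] -/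
theorem forall_center_mul_self_ne_of_finrank_two (h2 : Module.finrank ℚ X₂.endAlgebra = 2) (hX₂0 : 0 < X₂.dim)
    {φ : X₂ ⟶ X₂} {d d₀ : ℕ} (hd : 0 < d) (hd₀ : 0 < d₀) (hφ : φ ≫ φ = -(d • 𝟙 X₂))
    (hfree : ∀ q : ℚ, (d₀ : ℚ) ≠ q ^ 2 * d) :
    ∀ z ∈ Subalgebra.center ℚ X₂.endAlgebra, z * z ≠ -((d₀ : ℚ) • 1) := by
  intro z _
  haveI : Module.Finite ℚ X₂.endAlgebra := AbelianVariety.finiteDimensional_endAlgebra_holds X₂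
  haveI : Nontrivial X₂.endAlgebra := nontrivial_endAlgebra_of_dim_pos hX₂0
  exact forall_mul_self_ne_of_forall_ne_sq_mul h2 (Nat.cast_pos.2 hd) (Nat.cast_pos.2 hd₀)
    (endAlgebra_of_mul_self_eq_neg hφ) hfree z

/-- **THM. 0.2 (2), CASE (f) with `End⁰(X₂) = k`, sentences 1–2, printed hypotheses**: `X₀`, `X₁` elliptic curves,
`X₁` with `χ₁ ≫ χ₁ = -d` (CM by `k = ℚ(√-d)`), «`X_0` and `X_1` are not isogenous», `X₂` simple of dimension `≥ 2`
with `End⁰(X₂) = k` (`dim_ℚ End⁰(X₂) = 2`, `φ ≫ φ = -d`). Then for every `N` the rational Hodge classes of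
`(X₁ × X₂)^{N+1} × X₀^{N+1}` are spanned by products of Hodge classes of the two factors («For every `n ≥ 1` the
Hodge ring `B•(Xⁿ)` is generated by the images of `B•(X_0ⁿ)` and `B•(X_1ⁿ × X_2ⁿ)`»): the tree's
`hodgeClassesProductSpan_powSucc_powSucc_caseF`, its hypothesis `hcen` supplied by §1 and
`forall_ne_sq_mul_of_not_isIsogenous_curves`. [cite: MoonenZarhin1999LowDim, Thm. 0.2 (2) with case (f), §5 (5.11) and (5.12)] -/
theorem hodgeClassesProductSpan_powSucc_powSucc_caseF_of_finrank_two (hX₀ : X₀.dim = 1) (hX₁ : X₁.dim = 1)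
    (hni : ¬ AbelianVariety.IsIsogenous X₀ X₁) (χ₁ : X₁ ⟶ X₁) {d : ℕ} (hd : 0 < d) (hχ₁ : χ₁ ≫ χ₁ = -(d • 𝟙 X₁))
    (hX₂ : X₂.IsSimple) (hX₂2 : 2 ≤ X₂.dim) (h2 : Module.finrank ℚ X₂.endAlgebra = 2) (φ : X₂ ⟶ X₂)
    (hφ : φ ≫ φ = -(d • 𝟙 X₂)) (N : ℕ) :
    HodgeClassesProductSpan ((X₁.prod X₂).powSucc N) (X₀.powSucc N) :=
  hodgeClassesProductSpan_powSucc_powSucc_caseF hX₀ hX₁ (isOfCMType_of_hom_comp_self_eq_neg hX₁ hd hχ₁) hni hX₂ hX₂2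
    (fun _ _ hd₀ hχ₀ => forall_center_mul_self_ne_of_finrank_two h2 (by omega) hd hd₀ hφ
      (forall_ne_sq_mul_of_not_isIsogenous_curves hX₀ hX₁ hni hd₀ hd hχ₀ hχ₁)) N

/-- The same, one slot on each side and the order of the paper: `HodgeClassesProductSpan X₀ (X₁ × X₂)`.
[cite: MoonenZarhin1999LowDim, Thm. 0.2 (2) with case (f)] -/
theorem hodgeClassesProductSpan_caseF_of_finrank_two (hX₀ : X₀.dim = 1) (hX₁ : X₁.dim = 1)
    (hni : ¬ AbelianVariety.IsIsogenous X₀ X₁) (χ₁ : X₁ ⟶ X₁) {d : ℕ} (hd : 0 < d) (hχ₁ : χ₁ ≫ χ₁ = -(d • 𝟙 X₁))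
    (hX₂ : X₂.IsSimple) (hX₂2 : 2 ≤ X₂.dim) (h2 : Module.finrank ℚ X₂.endAlgebra = 2) (φ : X₂ ⟶ X₂)
    (hφ : φ ≫ φ = -(d • 𝟙 X₂)) : HodgeClassesProductSpan X₀ (X₁.prod X₂) :=
  hodgeClassesProductSpan_caseF hX₀ hX₁ (isOfCMType_of_hom_comp_self_eq_neg hX₁ hd hχ₁) hni hX₂ hX₂2
    fun _ _ hd₀ hχ₀ => forall_center_mul_self_ne_of_finrank_two h2 (by omega) hd hd₀ hφ
      (forall_ne_sq_mul_of_not_isIsogenous_curves hX₀ hX₁ hni hd₀ hd hχ₀ hχ₁)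

/-! ### §2 Sentence 3 read for the Hodge conjecture: `X₀ × X₁ × X₂` modulo the Weil classes of the fourfold `X₁ × X₂` -/

/-- **THM. 0.2 (2), CASE (f) with `End⁰(X₂) = k` — the Hodge conjecture for `X = X₀ × (X₁ × X₂)` MODULO the
algebraicity of the Weil classes of abelian fourfolds** («In particular, `B•(X)` is generated by the divisor classes
`D•(X)` together with the pull-backs of the Weil classes in `W_k ⊂ B²(X_1 × X_2)`», read: the only possibly
non-algebraic generators are the Weil classes of the fourfold `X₁ × X₂`). Hypotheses: `X₀`, `X₁` elliptic curves,
`X₀ ≁ X₁`; `X₂` a simple threefold with `End⁰(X₂) = k` acting with multiplicities `(2,1)` (`dim_ℚ End⁰(X₂) = 2`,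
`φ ≫ φ = -d`, multiplicity `1` at `μ₀ ∈ {± i√d}`), `X₁` with `χ₁ ≫ χ₁ = -d` of multiplicity `1` at the same `μ₀`
(the embedding `k ↪ End⁰(X₂)` of case (a), normalized as in the tree's R30); and the tree's named fact
`Markman2025_weilClasses_algebraic_abelianFourfold` as an explicit hypothesis. Proof: product span (§1) + the Hodge
conjecture for `X₁ × X₂` from `UnitaryTwoOneTimesCMCurveWeilClasses` (`B•(X₂ × X₁) ⊆ D• + W_k`, Lefschetz `(1,1)`,
the hypothesis on `W_k`) transported along `X₁ × X₂ ∼ X₂ × X₁`, + the curve `X₀`.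
[cite: MoonenZarhin1999LowDim, Thm. 0.2 (2) with case (f)] [cite: MoonenZarhin1999LowDim, Thm. 0.1 (1) with case (a)]
[cite: vanGeemen1994HodgeAV, Lemma 3.7 and Thm. 6.12] -/
theorem hodgeConjectureFor_caseF_of_weilClassesFourfold (hMark : Markman2025_weilClasses_algebraic_abelianFourfold)
    (hX₀ : X₀.dim = 1) (hX₁ : X₁.dim = 1) (hni : ¬ AbelianVariety.IsIsogenous X₀ X₁) (hX₂ : X₂.IsSimple)
    (hX₂3 : X₂.dim = 3) (h2 : Module.finrank ℚ X₂.endAlgebra = 2) (φ : X₂ ⟶ X₂) {d : ℕ} (hd : 0 < d)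
    (hφ : φ ≫ φ = -(d • 𝟙 X₂)) {μ₀ : ℂ}
    (hμ₀ : μ₀ = Complex.I * (Real.sqrt d : ℂ) ∨ μ₀ = -(Complex.I * (Real.sqrt d : ℂ)))
    (hm₂ : eigenMultiplicity X₂ φ μ₀ = 1) (χ₁ : X₁ ⟶ X₁) (hχ₁ : χ₁ ≫ χ₁ = -(d • 𝟙 X₁))
    (hm₁ : eigenMultiplicity X₁ χ₁ μ₀ = 1) :
    HodgeConjectureFor (X₀.prod (X₁.prod X₂)).dim (X₀.prod (X₁.prod X₂)).X :=
  hodgeConjectureFor_caseF_of_hodgeConjectureFor hX₀ hX₁ (isOfCMType_of_hom_comp_self_eq_neg hX₁ hd hχ₁) hni hX₂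
    (by omega)
    (fun _ _ hd₀ hχ₀ => forall_center_mul_self_ne_of_finrank_two h2 (by omega) hd hd₀ hφ
      (forall_ne_sq_mul_of_not_isIsogenous_curves hX₀ hX₁ hni hd₀ hd hχ₀ hχ₁))
    (HodgeConjectureFor.of_isIsogenous (isIsogenous_prod_swap X₁ X₂)
      (hodgeConjectureFor_prod_cmCurve_of_unitaryTwoOne_of_weilClassesFourfold hMark hX₂3 h2 φ hd hφ hμ₀ hm₂ hX₁ χ₁
        hχ₁ hm₁))

/-- **Case (f) as printed — «`X` is isogenous to a product `X_0 × X_1 × X_2`»**: the Hodge conjecture for every `X`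
isogenous to `X₀ × (X₁ × X₂)` as above, modulo the Weil classes of abelian fourfolds (van Geemen's Lemma 3.7: the
Hodge conjecture is isogeny invariant). [cite: MoonenZarhin1999LowDim, Thm. 0.2 (2) with case (f)]
[cite: vanGeemen1994HodgeAV, Lemma 3.7] -/
theorem hodgeConjectureFor_of_isIsogenous_caseF_of_weilClassesFourfold
    (hMark : Markman2025_weilClasses_algebraic_abelianFourfold) {X : AbelianVariety ℂ}
    (hX : AbelianVariety.IsIsogenous X (X₀.prod (X₁.prod X₂)))
    (hX₀ : X₀.dim = 1) (hX₁ : X₁.dim = 1) (hni : ¬ AbelianVariety.IsIsogenous X₀ X₁) (hX₂ : X₂.IsSimple)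
    (hX₂3 : X₂.dim = 3) (h2 : Module.finrank ℚ X₂.endAlgebra = 2) (φ : X₂ ⟶ X₂) {d : ℕ} (hd : 0 < d)
    (hφ : φ ≫ φ = -(d • 𝟙 X₂)) {μ₀ : ℂ}
    (hμ₀ : μ₀ = Complex.I * (Real.sqrt d : ℂ) ∨ μ₀ = -(Complex.I * (Real.sqrt d : ℂ)))
    (hm₂ : eigenMultiplicity X₂ φ μ₀ = 1) (χ₁ : X₁ ⟶ X₁) (hχ₁ : χ₁ ≫ χ₁ = -(d • 𝟙 X₁))
    (hm₁ : eigenMultiplicity X₁ χ₁ μ₀ = 1) : HodgeConjectureFor X.dim X.X :=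
  HodgeConjectureFor.of_isIsogenous hX (hodgeConjectureFor_caseF_of_weilClassesFourfold hMark hX₀ hX₁ hni hX₂ hX₂3 h2
    φ hd hφ hμ₀ hm₂ χ₁ hχ₁ hm₁)

/- **On path**: the Hodge conjecture gives every target of this file (the tree's
`hodgeConjectureFor_prod_of_hodgeConjecture'`); here it is reduced, for case (f), to the Weil classes of fourfolds. -/
example (h : ∀ ⦃n : ℕ⦄ ⦃X : Motives.SchemeOver ℂ⦄, Motives.IsSmoothProjective n X → HodgeConjectureFor n X)
    (X₀ X₁ X₂ : AbelianVariety ℂ) : HodgeConjectureFor (X₀.prod (X₁.prod X₂)).dim (X₀.prod (X₁.prod X₂)).X :=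
  hodgeConjectureFor_prod_of_hodgeConjecture' h X₀ (X₁.prod X₂)

end Literature.AlgebraicGeometry.HodgeTheory
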